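import Summits.QuantumFields.QCD.Theorems.SpectralDefectExtinctionWindowExtinctionStubFluxTemplateHalfSpectral
import Summits.QuantumFields.QCD.Theorems.SpectralDefectExtinctionWindowExtinctionStubFluxTemplateHalfCycle
import HarnessLib

/-!
# Coercivity of the Wilson form near the centre-flux box template
# (stub `stub_fluxTemplateHalf`, part 3 of 3: registered fragment `stub_fluxTemplateHalf_coercive`)

Helper file for stub `stub_fluxTemplateHalf` (S5b-m) of line `free-volume-heavy-witness` (reshape r3)
of crux `Summit.QuantumFields.QCD.Theses.SpectralDefectExtinction.WindowExtinction`
(item stmt-QuantumFields-8964).  Tree vocabulary only (`wilsonDirac`, `box`, `Torus.proj`,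
`GaugeConfig`); parts 1–2 are `…StubFluxTemplateHalfCycle.lean` (the magnetic four-cycle bound
`stub_fluxTemplateHalf_cycle`, the link perturbation `fluxHalf_edge_bound`) and
`…StubFluxTemplateHalfSpectral.lean` (`fluxHalf_re_form_wilsonDirac_eq`, the box embedding lemmas,
the chiral min–max `stub_fluxTemplateHalf_spectral`).

* `fluxHalf_sum_shift`: a sum over `{-R-D,…,R+D}⁴` of a shift (sup-norm `≤ D`) of a function supported
  in `{-R,…,R}⁴` is the plain sum over the box (`finsum` reindexing along `Equiv.addRight`).
* `fluxHalf_plane_bound`: **plaquette-cycle decomposition in one plane.**  For a colour–spinor field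
  `φ` on `ℤ⁴` supported in the box, trivial phases on the `μ`-links and unit scalar phases `u` on the
  `ν`-links with `u(y+e_μ) ū(y) = ω = -1/2 + i√3/2` (every `(μ,ν)`-plaquette has holonomy `ω`), the
  hopping form of the plane is `≤ √3‖φ‖²`: summing the four-cycle bound of part 1 over all plaquettes
  based in the bigger box counts every link term exactly twice and every site mass four times
  (boundary plaquettes are partial cycles with zero corner vectors).
* `fluxHalf_model_bound`: with links entrywise within `η` of the centre-flux template
  (`V₀ ≈ 1`, `V₁(y) ≈ ω^{y₀+R}`, `V₂ ≈ 1`, `V₃(y) ≈ ω^{y₂+R}`) the total hopping form on `ℤ⁴` is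
  `≤ (2√3 + 12η)‖φ‖²` (planes `(0,1)` and `(2,3)`; `3η` per link from `fluxHalf_edge_bound`).
* `stub_fluxTemplateHalf_coercive` (registered): on the torus of side `n > 2R+1`, for spinors `ψ`
  supported on the image of the box `c + {-R,…,R}⁴` and links of `U` over the box within `η` of the
  template, `(m + 4 − 2√3 − 12η)‖ψ‖² ≤ Re⟨ψ, D_W(U,m,1)ψ⟩` (`√3` abstracted as `s > 0`, `s² = 3`):
  pull back along the box embedding and apply the model bound to
  `Re⟨ψ, D_W ψ⟩ = (m+4)‖ψ‖² − Σ_μ H_μ`.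
-/

noncomputable section

namespace Summit.QuantumFields.QCD.Cruxes.WindowExtinction.FreeVolumeHeavyWitness

open Matrix MeasureTheory
open Literature.MathematicalPhysics Literature.MathematicalPhysics.QuantumLattice
  Literature.MathematicalPhysics.QuantumFieldTheory Literature.Probability.LatticeModels
open Summit.QuantumFields.QCD.Theorems.ExtinctionBuildsQCD.Negative
open scoped BigOperators Classical ComplexConjugate

/-! ## Shifted sums of box-supported functions on `ℤ⁴` -/

/-- A sum over the bigger box `{-R-D,…,R+D}⁴` of a shift (by a vector of sup-norm `≤ D`) of a
function supported in the box `{-R,…,R}⁴` is the sum of the function over the box. -/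
theorem fluxHalf_sum_shift {R D : ℕ} (g : (Fin 4 → ℤ) → ℝ) (hg : ∀ y, y ∉ box 4 R → g y = 0)
    (v : Fin 4 → ℤ) (hv : ∀ k, |v k| ≤ D) :
    ∑ y ∈ box 4 (R + D), g (y + v) = ∑ y ∈ box 4 R, g y := by
  have h1 : (Function.support fun y => g (y + v)) ⊆ ↑(box 4 (R + D)) := by
    intro y hy
    rw [Function.mem_support] at hy
    have hyv : y + v ∈ box 4 R := by
      by_contra h
      exact hy (hg _ h)
    rw [Finset.mem_coe, mem_box]
    intro k
    have h2 := (mem_box.1 hyv) k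
    have h3 := hv k
    rw [abs_le] at h3
    simp only [Pi.add_apply] at h2
    push_cast
    constructor <;> omega
  have h2 : Function.support g ⊆ ↑(box 4 R) := by
    intro y hy
    rw [Function.mem_support] at hy
    rw [Finset.mem_coe]
    by_contra h
    exact hy (hg _ h)
  rw [← finsum_eq_sum_of_support_subset _ h1, ← finsum_eq_sum_of_support_subset _ h2]
  exact finsum_comp_equiv (Equiv.addRight v)

/-! ## The magnetic bound in one plane (plaquette-cycle decomposition) -/

/-- **Plaquette-cycle decomposition in one plane.**  For a colour–spinor field `φ` on `ℤ⁴` supported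
in the box, unit scalar phases `u` on the `ν`-links with `u(y + e_μ) ū(y) = ω` (every
`(μ, ν)`-plaquette has holonomy `ω = e^{2πi/3}`) and trivial phases on the `μ`-links, the hopping
form of the plane is at most `√3 ‖φ‖²`: each link lies in exactly two plaquettes of the plane, and
each plaquette four-cycle is bounded by `stub_fluxTemplateHalf_cycle`. -/
theorem fluxHalf_plane_bound {R : ℕ} (s : ℝ) (hs : s * s = 3) (hs0 : 0 < s)
    (φ : (Fin 4 → ℤ) → (Fin 3 × Fin 4 → ℂ)) (hφ : ∀ y, y ∉ box 4 R → φ y = 0)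
    (μ ν : Fin 4) (u : (Fin 4 → ℤ) → ℂ) (hu1 : ∀ y, Complex.normSq (u y) = 1)
    (hhol : ∀ y, u (y + Pi.single μ 1) * conj (u y) = (⟨-1 / 2, s / 2⟩ : ℂ)) :
    ∑ y ∈ box 4 R, ((1 : ℂ) * (star (φ y) ⬝ᵥ φ (y + Pi.single μ 1))).re +
        ∑ y ∈ box 4 R, (u y * (star (φ y) ⬝ᵥ φ (y + Pi.single ν 1))).re ≤
      s * ∑ y ∈ box 4 R, ∑ q, ‖φ y q‖ ^ 2 := by
  set eμ : Fin 4 → ℤ := Pi.single μ 1 with heμ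
  set eν : Fin 4 → ℤ := Pi.single ν 1 with heν
  set f0 : (Fin 4 → ℤ) → ℝ := fun y => ((1 : ℂ) * (star (φ y) ⬝ᵥ φ (y + eμ))).re with hf0
  set f1 : (Fin 4 → ℤ) → ℝ := fun y => (u y * (star (φ y) ⬝ᵥ φ (y + eν))).re with hf1
  set M : (Fin 4 → ℤ) → ℝ := fun y => ∑ q, ‖φ y q‖ ^ 2 with hM
  have hf0z : ∀ y, y ∉ box 4 R → f0 y = 0 := fun y hy => by
    simp only [hf0, hφ y hy, star_zero, zero_dotProduct, mul_zero, Complex.zero_re]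
  have hf1z : ∀ y, y ∉ box 4 R → f1 y = 0 := fun y hy => by
    simp only [hf1, hφ y hy, star_zero, zero_dotProduct, mul_zero, Complex.zero_re]
  have hMz : ∀ y, y ∉ box 4 R → M y = 0 := fun y hy => by
    simp only [hM, hφ y hy, Pi.zero_apply, norm_zero]
    simp
  have hcomm : ∀ y : Fin 4 → ℤ, y + eν + eμ = y + eμ + eν := fun y => add_right_comm _ _ _
  -- bounds on single unit vectors
  have he1 : ∀ (κ : Fin 4) (k : Fin 4), |(Pi.single κ (1 : ℤ) : Fin 4 → ℤ) k| ≤ (2 : ℕ) := by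
    intro κ k
    by_cases hk : k = κ
    · subst hk; simp
    · simp [hk]
  have he2 : ∀ k : Fin 4, |(eμ + eν) k| ≤ (2 : ℕ) := by
    intro k
    have h1 : |eμ k| ≤ 1 := by
      by_cases hk : k = μ
      · subst hk; simp [heμ]
      · simp [heμ, hk]
    have h2 : |eν k| ≤ 1 := by
      by_cases hk : k = ν
      · subst hk; simp [heν]
      · simp [heν, hk]
    rw [Pi.add_apply]
    refine (abs_add_le _ _).trans ?_
    push_cast
    linarith
  have he0 : ∀ k : Fin 4, |(0 : Fin 4 → ℤ) k| ≤ (2 : ℕ) := fun k => by simp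
  -- the plaquette four-cycles, summed over the big box
  have hcyc : ∀ y : Fin 4 → ℤ,
      2 * (f0 y + f1 (y + eμ) + f0 (y + eν) + f1 y) ≤
        s * (M y + M (y + eμ) + M (y + eμ + eν) + M (y + eν)) := by
    intro y
    have key := stub_fluxTemplateHalf_cycle s hs hs0 (φ y) (φ (y + eμ)) (φ (y + eμ + eν)) (φ (y + eν))
      1 (u (y + eμ)) 1 (u y) (by simp) (hu1 _) (by simp)
      (by rw [one_mul, map_one, mul_one]; exact hhol y)
    have hre : (1 * (star (φ y) ⬝ᵥ φ (y + eμ)) + u (y + eμ) * (star (φ (y + eμ)) ⬝ᵥ φ (y + eμ + eν)) +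
        1 * (star (φ (y + eν)) ⬝ᵥ φ (y + eμ + eν)) + u y * (star (φ y) ⬝ᵥ φ (y + eν))).re =
        f0 y + f1 (y + eμ) + f0 (y + eν) + f1 y := by
      simp only [Complex.add_re, hf0, hf1, hcomm]
    rw [hre] at key
    exact key
  have hsum := Finset.sum_le_sum fun y (_ : y ∈ box 4 (R + 2)) => hcyc y
  rw [← Finset.mul_sum, ← Finset.mul_sum] at hsum
  simp only [Finset.sum_add_distrib] at hsum
  -- identify the shifted sums
  have s1 : ∑ y ∈ box 4 (R + 2), f0 y = ∑ y ∈ box 4 R, f0 y := by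
    simpa using fluxHalf_sum_shift f0 hf0z 0 he0
  have s2 : ∑ y ∈ box 4 (R + 2), f1 (y + eμ) = ∑ y ∈ box 4 R, f1 y :=
    fluxHalf_sum_shift f1 hf1z eμ (he1 μ)
  have s3 : ∑ y ∈ box 4 (R + 2), f0 (y + eν) = ∑ y ∈ box 4 R, f0 y :=
    fluxHalf_sum_shift f0 hf0z eν (he1 ν)
  have s4 : ∑ y ∈ box 4 (R + 2), f1 y = ∑ y ∈ box 4 R, f1 y := by
    simpa using fluxHalf_sum_shift f1 hf1z 0 he0
  have m1 : ∑ y ∈ box 4 (R + 2), M y = ∑ y ∈ box 4 R, M y := by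
    simpa using fluxHalf_sum_shift M hMz 0 he0
  have m2 : ∑ y ∈ box 4 (R + 2), M (y + eμ) = ∑ y ∈ box 4 R, M y :=
    fluxHalf_sum_shift M hMz eμ (he1 μ)
  have m3 : ∑ y ∈ box 4 (R + 2), M (y + eμ + eν) = ∑ y ∈ box 4 R, M y := by
    have := fluxHalf_sum_shift M hMz (eμ + eν) he2
    simpa only [add_assoc] using this
  have m4 : ∑ y ∈ box 4 (R + 2), M (y + eν) = ∑ y ∈ box 4 R, M y :=
    fluxHalf_sum_shift M hMz eν (he1 ν)
  rw [s1, s2, s3, s4, m1, m2, m3, m4] at hsum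
  have hMnn : 0 ≤ ∑ y ∈ box 4 R, M y :=
    Finset.sum_nonneg fun y _ => Finset.sum_nonneg fun q _ => by positivity
  change ∑ y ∈ box 4 R, f0 y + ∑ y ∈ box 4 R, f1 y ≤ s * ∑ y ∈ box 4 R, M y
  nlinarith

/-! ## The model bound on `ℤ⁴`: all four hopping forms near the centre-flux template -/

/-- Arithmetic of the centre phase `ω = -1/2 + i√3/2`: `|ω| = 1`. -/
theorem fluxHalf_normSq_omega (s : ℝ) (hs : s * s = 3) : Complex.normSq (⟨-1 / 2, s / 2⟩ : ℂ) = 1 := by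
  rw [Complex.normSq_mk]
  nlinarith

/-- `ω^{k+1} · conj(ω^k) = ω` for the unit complex number `ω`. -/
theorem fluxHalf_zpow_succ_mul_conj (ω : ℂ) (hω : Complex.normSq ω = 1) (k : ℤ) :
    ω ^ (k + 1) * conj (ω ^ k) = ω := by
  have hω0 : ω ≠ 0 := fun h => by simp [h] at hω
  have hc : conj ω = ω⁻¹ := by
    rw [Complex.inv_def, hω]
    simp
  rw [map_zpow₀, hc, _root_.inv_zpow', _root_.zpow_neg, zpow_add_one₀ hω0, mul_comm (ω ^ k) ω, mul_assoc,
    mul_inv_cancel₀ (zpow_ne_zero k hω0), mul_one]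

/-- **The model bound.**  For a colour–spinor field `φ` on `ℤ⁴` supported in the box `{-R,…,R}⁴` and
colour links `V` entrywise within `η` of the centre-flux template (`V₀ ≈ 1`, `V₁(y) ≈ ω^{y₀+R}`,
`V₂ ≈ 1`, `V₃(y) ≈ ω^{y₂+R}`), the total hopping form is at most `(2√3 + 12η)‖φ‖²`: the planes
`(0,1)` and `(2,3)` carry flux `ω` through every plaquette (`fluxHalf_plane_bound`, `≤ √3‖φ‖²` each
at the exact template) and each link perturbation costs `≤ 3η` in operator norm
(`fluxHalf_edge_bound`). -/
theorem fluxHalf_model_bound {R : ℕ} (s η : ℝ) (hs : s * s = 3) (hs0 : 0 < s) (hη : 0 ≤ η)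
    (φ : (Fin 4 → ℤ) → (Fin 3 × Fin 4 → ℂ)) (hφ : ∀ y, y ∉ box 4 R → φ y = 0)
    (V : (Fin 4 → ℤ) → Fin 4 → Matrix (Fin 3) (Fin 3) ℂ)
    (h0 : ∀ y ∈ box 4 R, ∀ a b, ‖V y 0 a b - 1 * (1 : Matrix (Fin 3) (Fin 3) ℂ) a b‖ ≤ η)
    (h1 : ∀ y ∈ box 4 R, ∀ a b,
      ‖V y 1 a b - (⟨-1 / 2, s / 2⟩ : ℂ) ^ (y 0 + R : ℤ) * (1 : Matrix (Fin 3) (Fin 3) ℂ) a b‖ ≤ η)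
    (h2 : ∀ y ∈ box 4 R, ∀ a b, ‖V y 2 a b - 1 * (1 : Matrix (Fin 3) (Fin 3) ℂ) a b‖ ≤ η)
    (h3 : ∀ y ∈ box 4 R, ∀ a b,
      ‖V y 3 a b - (⟨-1 / 2, s / 2⟩ : ℂ) ^ (y 2 + R : ℤ) * (1 : Matrix (Fin 3) (Fin 3) ℂ) a b‖ ≤ η) :
    ∑ μ : Fin 4, ∑ y ∈ box 4 R, (∑ a, ∑ α, conj (φ y (a, α)) *
        ∑ b, V y μ a b * φ (y + Pi.single μ 1) (b, α)).re ≤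
      (2 * s + 12 * η) * ∑ y ∈ box 4 R, ∑ q, ‖φ y q‖ ^ 2 := by
  set ω : ℂ := ⟨-1 / 2, s / 2⟩ with hω
  have hnormSq : Complex.normSq ω = 1 := fluxHalf_normSq_omega s hs
  have hu1 : ∀ k : ℤ, Complex.normSq (ω ^ k) = 1 := fun k => by
    rw [map_zpow₀, hnormSq, _root_.one_zpow]
  -- the two flux planes
  have hp01 := fluxHalf_plane_bound s hs hs0 φ hφ 0 1 (fun y => ω ^ (y 0 + R : ℤ)) (fun y => hu1 _)
    (fun y => by
      simp only [Pi.add_apply, Pi.single_eq_same]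
      rw [show (y 0 + 1 + (R : ℤ)) = (y 0 + R) + 1 by ring]
      exact fluxHalf_zpow_succ_mul_conj ω hnormSq _)
  have hp23 := fluxHalf_plane_bound s hs hs0 φ hφ 2 3 (fun y => ω ^ (y 2 + R : ℤ)) (fun y => hu1 _)
    (fun y => by
      simp only [Pi.add_apply, Pi.single_eq_same]
      rw [show (y 2 + 1 + (R : ℤ)) = (y 2 + R) + 1 by ring]
      exact fluxHalf_zpow_succ_mul_conj ω hnormSq _)
  -- shifted masses
  have hMz : ∀ y, y ∉ box 4 R → (fun y => ∑ q, ‖φ y q‖ ^ 2) y = 0 := fun y hy => by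
    simp only [hφ y hy, Pi.zero_apply, norm_zero]
    simp
  have he1 : ∀ (κ : Fin 4) (k : Fin 4), |(Pi.single κ (1 : ℤ) : Fin 4 → ℤ) k| ≤ (2 : ℕ) := by
    intro κ k
    by_cases hk : k = κ
    · subst hk; simp
    · simp [hk]
  have hMs : ∀ μ : Fin 4, ∑ y ∈ box 4 R, ∑ q, ‖φ (y + Pi.single μ 1) q‖ ^ 2 ≤
      ∑ y ∈ box 4 R, ∑ q, ‖φ y q‖ ^ 2 := by
    intro μ
    calc ∑ y ∈ box 4 R, ∑ q, ‖φ (y + Pi.single μ 1) q‖ ^ 2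
        ≤ ∑ y ∈ box 4 (R + 2), ∑ q, ‖φ (y + Pi.single μ 1) q‖ ^ 2 :=
          Finset.sum_le_sum_of_subset_of_nonneg (box_mono 4 (by omega))
            (fun y _ _ => Finset.sum_nonneg fun q _ => by positivity)
      _ = ∑ y ∈ box 4 R, ∑ q, ‖φ y q‖ ^ 2 :=
          fluxHalf_sum_shift (fun y => ∑ q, ‖φ y q‖ ^ 2) hMz _ (he1 μ)
  -- the link perturbations, summed over the box
  have hL : ∀ (μ : Fin 4) (u : (Fin 4 → ℤ) → ℂ),
      (∀ y ∈ box 4 R, ∀ a b, ‖V y μ a b - u y * (1 : Matrix (Fin 3) (Fin 3) ℂ) a b‖ ≤ η) →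
      2 * ∑ y ∈ box 4 R, (∑ a, ∑ α, conj (φ y (a, α)) *
          ∑ b, V y μ a b * φ (y + Pi.single μ 1) (b, α)).re ≤
        2 * ∑ y ∈ box 4 R, (u y * (star (φ y) ⬝ᵥ φ (y + Pi.single μ 1))).re +
          6 * η * ∑ y ∈ box 4 R, ∑ q, ‖φ y q‖ ^ 2 := by
    intro μ u hu
    have h := Finset.sum_le_sum fun y hy =>
      fluxHalf_edge_bound (V y μ) (u y) hη (φ y) (φ (y + Pi.single μ 1)) (Or.inr (hu y hy))
    rw [← Finset.mul_sum, Finset.sum_add_distrib, ← Finset.mul_sum, ← Finset.mul_sum,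
      Finset.sum_add_distrib] at h
    have h2 := hMs μ
    have h3 : 3 * η * ∑ y ∈ box 4 R, ∑ q, ‖φ (y + Pi.single μ 1) q‖ ^ 2 ≤
        3 * η * ∑ y ∈ box 4 R, ∑ q, ‖φ y q‖ ^ 2 :=
      mul_le_mul_of_nonneg_left h2 (by positivity)
    linarith
  have hL0 := hL 0 (fun _ => 1) h0
  have hL1 := hL 1 (fun y => ω ^ (y 0 + R : ℤ)) h1
  have hL2 := hL 2 (fun _ => 1) h2
  have hL3 := hL 3 (fun y => ω ^ (y 2 + R : ℤ)) h3
  rw [Fin.sum_univ_four]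
  linarith

/-! ## The registered coercivity fragment -/

/-- **Registered helper `stub_fluxTemplateHalf_coercive` (coercivity of the Wilson form near the
centre-flux template).**  On the torus of side `n > 2R+1`, if the links of `U` based in the image of the
box `c + {-R,…,R}⁴` are entrywise within `η` of the centre-flux template (`U₀ = 1`, `U₁(y) = ω^{y₀+R}·1`,
`U₂ = 1`, `U₃(y) = ω^{y₂+R}·1`, `ω = -1/2 + i√3/2`), then for every spinor `ψ` supported on the image
of the box `Re⟨ψ, D_W(U,m,1)ψ⟩ ≥ (m + 4 − 2√3 − 12η)‖ψ‖²`: pull `ψ` back to `ℤ⁴` along the box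
embedding (`fluxHalf_sum_torus_eq_sum_box`, `fluxHalf_box_neighbour_eq`), write the form as mass term
minus hopping forms (`fluxHalf_re_form_wilsonDirac_eq`) and apply `fluxHalf_model_bound`. -/
theorem stub_fluxTemplateHalf_coercive :
    ∀ (R : ℕ) (s η : ℝ), s * s = 3 → 0 < s → 0 ≤ η → ∀ (n : ℕ) [NeZero n], 2 * R + 1 < n →
      ∀ (c : Fin 4 → ℤ) (U : GaugeConfig 4 n SU3),
      (∀ y ∈ box 4 R, ∀ a b, ‖(U (Torus.proj n (c + y), 0) : Matrix (Fin 3) (Fin 3) ℂ) a b -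
        (1 : Matrix (Fin 3) (Fin 3) ℂ) a b‖ ≤ η) →
      (∀ y ∈ box 4 R, ∀ a b, ‖(U (Torus.proj n (c + y), 1) : Matrix (Fin 3) (Fin 3) ℂ) a b -
        (⟨-1 / 2, s / 2⟩ : ℂ) ^ (y 0 + R : ℤ) * (1 : Matrix (Fin 3) (Fin 3) ℂ) a b‖ ≤ η) →
      (∀ y ∈ box 4 R, ∀ a b, ‖(U (Torus.proj n (c + y), 2) : Matrix (Fin 3) (Fin 3) ℂ) a b -
        (1 : Matrix (Fin 3) (Fin 3) ℂ) a b‖ ≤ η) →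
      (∀ y ∈ box 4 R, ∀ a b, ‖(U (Torus.proj n (c + y), 3) : Matrix (Fin 3) (Fin 3) ℂ) a b -
        (⟨-1 / 2, s / 2⟩ : ℂ) ^ (y 2 + R : ℤ) * (1 : Matrix (Fin 3) (Fin 3) ℂ) a b‖ ≤ η) →
      ∀ (m : ℝ) (ψ : TorusSite 4 n × Fin 3 × Fin 4 → ℂ),
      (∀ p : TorusSite 4 n × Fin 3 × Fin 4,
        (¬ ∃ y : ↥(box 4 R), Torus.proj n (c + (y : Fin 4 → ℤ)) = p.1) → ψ p = 0) →
      (m + 4 - 2 * s - 12 * η) * ∑ i, ‖ψ i‖ ^ 2 ≤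
        (star ψ ⬝ᵥ (wilsonDirac (fundamentalRep (Fin 3)) U m 1 *ᵥ ψ)).re := by
  intro R s η hs hs0 hη n _ hn c U h0 h1 h2 h3 m ψ hψ
  -- the pulled-back field on ℤ⁴ and the pulled-back links
  set φ : (Fin 4 → ℤ) → (Fin 3 × Fin 4 → ℂ) :=
    fun y => if y ∈ box 4 R then fun q => ψ (Torus.proj n (c + y), q) else 0 with hφ
  set V : (Fin 4 → ℤ) → Fin 4 → Matrix (Fin 3) (Fin 3) ℂ :=
    fun y μ => (U (Torus.proj n (c + y), μ) : Matrix (Fin 3) (Fin 3) ℂ) with hV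
  have hφz : ∀ y, y ∉ box 4 R → φ y = 0 := fun y hy => by simp only [hφ, if_neg hy]
  have hφm : ∀ y ∈ box 4 R, ∀ q, φ y q = ψ (Torus.proj n (c + y), q) := fun y hy q => by
    simp only [hφ, if_pos hy]
  have hφn : ∀ y ∈ box 4 R, ∀ (μ : Fin 4) q,
      ψ (Torus.proj n (c + (y + Pi.single μ 1)), q) = φ (y + Pi.single μ 1) q := by
    intro y hy μ q
    by_cases hy' : y + Pi.single μ 1 ∈ box 4 R
    · rw [hφm _ hy']
    · rw [hφz _ hy', Pi.zero_apply]
      refine hψ _ ?_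
      rintro ⟨⟨y', hy'm⟩, h⟩
      exact hy' (fluxHalf_box_neighbour_eq hn c hy hy'm μ h ▸ hy'm)
  -- mass
  have hmass : ∑ i, ‖ψ i‖ ^ 2 = ∑ y ∈ box 4 R, ∑ q, ‖φ y q‖ ^ 2 := by
    rw [Fintype.sum_prod_type, fluxHalf_sum_torus_eq_sum_box hn c (fun x => ∑ q, ‖ψ (x, q)‖ ^ 2) ?_]
    · refine Finset.sum_congr rfl fun y hy => ?_
      simp only [hφm y hy]
    · intro x hx
      refine Finset.sum_eq_zero fun q _ => ?_
      rw [hψ (x, q) hx, norm_zero]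
      simp
  -- hopping forms
  have hhop : ∀ μ : Fin 4, ∑ x, (∑ a, ∑ α, conj (ψ (x, a, α)) *
      ∑ b, (U (x, μ) : Matrix (Fin 3) (Fin 3) ℂ) a b * ψ (QuantumFieldTheory.Site.shift x μ, b, α)).re =
      ∑ y ∈ box 4 R, (∑ a, ∑ α, conj (φ y (a, α)) *
        ∑ b, V y μ a b * φ (y + Pi.single μ 1) (b, α)).re := by
    intro μ
    rw [fluxHalf_sum_torus_eq_sum_box hn c _ ?_]
    · refine Finset.sum_congr rfl fun y hy => ?_
      simp only [hφm y hy, fluxHalf_proj_add_shift, hφn y hy, hV]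
    · intro x hx
      have : ∀ a α, ψ (x, a, α) = 0 := fun a α => hψ (x, a, α) hx
      simp only [this, map_zero, zero_mul, Finset.sum_const_zero, Complex.zero_re]
  -- the model bound
  have key := fluxHalf_model_bound s η hs hs0 hη φ hφz V
    (fun y hy a b => by rw [one_mul]; exact h0 y hy a b) (fun y hy a b => h1 y hy a b)
    (fun y hy a b => by rw [one_mul]; exact h2 y hy a b) (fun y hy a b => h3 y hy a b)
  rw [fluxHalf_re_form_wilsonDirac_eq, hmass]
  simp only [hhop]
  linarith
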